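import Summits.AnomalousDissipation.AnomalousDissipation.Theses.AttractorShadow
import Summits.AnomalousDissipation.AnomalousDissipation.Theses.DutyCycle
import Literature.Analysis.FluidPDE.LerayHopfUniformEnergyMomentum
import Literature.Analysis.FluidPDE.DoeringFoiasProofs
import Literature.Analysis.FluidPDE.LongTimeAverageSunrise
import Literature.Analysis.FluidPDE.CheskidovAssemblyTools
import HarnessLib

/-! # The HIGH-DUTY DOOR of the residual `DutyCycle.SlimDensityRealisesPower` (item stmt-AnomalousDissipation-27339)
— decomp-ad lens-3 g60

LANDABLE FORM (intended tree path `Summits/AnomalousDissipation/AnomalousDissipation/Theorems/DutyCycleHighDutyBookkeeping.lean`,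
namespace `Summit.AnomalousDissipation.AnomalousDissipation.Theorems.DutyCycle`; a prover-identity seat lands it with
`ledger propose --kind proof --target <that path> --supports stmt-AnomalousDissipation-27339` — it proves the registered
theorem-grade stub `stub_highDutyBookkeeping` BY NAME + SIGNATURE and the door theorem; planners do not propose into
Theorems/).

The residual crux Rβ2 `SlimDensityRealisesPower : SlimMeanDenseReturns → AttractorShadow.PowerFloorFamily` (D_E ⟹ P) has
the registered BC3 line «HIGH DUTY» (`SlimDensityRealisesPower_birth(_paste).lean`): `stub_dutySaturation : D_E → D♯`
(open, INSTRUMENTABLE, sufficient-only) and `stub_highDutyBookkeeping` (THEOREM-GRADE). The latter is PROVED here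
verbatim (`highDutyBookkeeping`): along ONE global Leray–Hopf trajectory with steady smooth mean-zero force `f`,
`ν > 0`, mean energy `⟨‖u‖₂²⟩ ≤ E` and a Lebesgue duty cycle `δ` of LOUD instants (`β ≤ (f, u(t))`) along times
`T → ∞`, the mean injected power is at least `β·δ − ‖f‖₂·√((1−δ)·E)`: during the loud phases the force injects
`≥ β` per unit time, during the remaining fraction `≤ 1 − δ` of time it can withdraw at most `‖f‖₂‖u(t)‖₂`, whose time
average is `≤ ‖f‖₂ √(1−δ) √E` by Cauchy–Schwarz in time. Consequently (`slimDensityRealisesPower_door`) every HIGH-DUTY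
dense slim-loud family (`‖f‖₂ √((1−δ)E) < β δ`, the ∃-statement `HighDutyDenseReturns` of the skeleton, INLINED) is a
`PowerFloorFamily` (item 24057, BY NAME): the residual is now open EXACTLY in the low-duty regime `β δ ≤ ‖f‖₂ √((1−δ)E)`
(content = irreversibility of the injected work), as its docstring records.

* §1 `integrableOn_sqrt`, `setIntegral_sqrt_le` — Cauchy–Schwarz in time `∫_A √g ≤ √|A| √(∫_A g)`;
  `dutyCycle_bookkeeping` — the pure real-analysis core: for `P ≥ −F√e` on `(0, T]`, `P ≥ β` on a measurable set of
  measure `≥ δT` and `∫₀ᵀ e ≤ E'T`, the running mean of `P` is `≥ βδ − F√((1−δ)E')`.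
* §2 `highDutyBookkeeping` (= registered `stub_highDutyBookkeeping`, verbatim): the loud set is measurable by weak `L²`
  continuity (`weak_continuous`, `ContinuousOn.measurable_piecewise`); `|(f, u(t))| ≤ ‖f‖₂‖u(t)‖₂ ≤ ‖f‖₂√R` by the
  momentum-free uniform energy bound `IsGlobalLerayHopf.exists_forall_integral_norm_sq_le_of_hasZeroMean`
  [FMRT2001, (A.42)], so the running means of the power are bounded and `Filter.le_limsup_of_frequently_le` is honest;
  `meanEnergy` is an honest limsup (`eventually_integral_lt_of_longTimeAvgSup_lt`), whence `∫₀ᵀ‖u‖₂² ≤ (E + η)T`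
  eventually; `η → 0⁺` by continuity.
* §3 the registered stub by name and the door `slimDensityRealisesPower_door : HighDutyDenseReturns-body → PowerFloorFamily`.
Tree facts used BY NAME: `Torus.IsLerayHopfOn.weak_continuous` [Galdi2000, Lemma 2.2], `Torus.IsLerayHopfOn.intervalIntegrable_power`,
`Torus.IsGlobalLerayHopf.exists_forall_integral_norm_sq_le_of_hasZeroMean` [FMRT2001, Ch. IV §3.1], `…integrableOn_integral_norm_sq`,
`…memLp_two`, `FluidPDE.abs_integral_inner_le_sqrt_mul_sqrt`, `isBoundedUnder_le_timeMean`, `eventually_integral_lt_of_longTimeAvgSup_lt`,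
`meanEnergy_eq_longTimeAvgSup`; Mathlib `integral_mul_le_Lp_mul_Lq_of_nonneg`, `integral_inter_add_sdiff`, `Filter.le_limsup_of_frequently_le`. -/

noncomputable section

-- `Summit.<Summit>.<Problem>` is the tree's mandated summit-side namespace (CONVENTIONS §2); for this
-- single-conjunct summit the two segments coincide, so the duplicate is deliberate.
set_option linter.dupNamespace false

open MeasureTheory Set Filter Topology
open scoped RealInnerProductSpace ENNReal
open Literature.Analysis Literature.Analysis.FluidPDE Literature.Analysis.FluidPDE.Torus

namespace Summit.AnomalousDissipation.AnomalousDissipation.Theorems.DutyCycle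

/-! ### §1 Real analysis: Cauchy–Schwarz in time and the duty-cycle bookkeeping inequality -/

/-- `√g` is integrable on a set of finite measure when `g ≥ 0` is (`√g ≤ 1 + g`). -/
theorem integrableOn_sqrt {A : Set ℝ} (hAfin : volume A ≠ ∞) {g : ℝ → ℝ} (hg0 : ∀ t, 0 ≤ g t)
    (hgi : IntegrableOn g A) : IntegrableOn (fun t => Real.sqrt (g t)) A := by
  haveI : IsFiniteMeasure (volume.restrict A) :=
    ⟨by rw [Measure.restrict_apply_univ]; exact hAfin.lt_top⟩
  have hmeas : AEStronglyMeasurable (fun t => Real.sqrt (g t)) (volume.restrict A) :=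
    Real.continuous_sqrt.comp_aestronglyMeasurable hgi.aestronglyMeasurable
  refine Integrable.mono' ((integrable_const (1:ℝ)).add hgi) hmeas (ae_of_all _ fun t => ?_)
  simp only [Pi.add_apply, Real.norm_eq_abs, abs_of_nonneg (Real.sqrt_nonneg _)]
  nlinarith [Real.sq_sqrt (hg0 t), Real.sqrt_nonneg (g t), sq_nonneg (Real.sqrt (g t) - 1 / 2)]

/-- **Cauchy–Schwarz in time**: `∫_A √g ≤ √|A| · √(∫_A g)` for `g ≥ 0` integrable on a set `A` of finite
measure (Hölder `(2, 2)` for `1 · √g`). -/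
theorem setIntegral_sqrt_le {A : Set ℝ} (hAfin : volume A ≠ ∞) {g : ℝ → ℝ} (hg0 : ∀ t, 0 ≤ g t)
    (hgi : IntegrableOn g A) :
    ∫ t in A, Real.sqrt (g t) ≤ Real.sqrt ((volume A).toReal) * Real.sqrt (∫ t in A, g t) := by
  haveI : IsFiniteMeasure (volume.restrict A) :=
    ⟨by rw [Measure.restrict_apply_univ]; exact hAfin.lt_top⟩
  have hmeas : AEStronglyMeasurable (fun t => Real.sqrt (g t)) (volume.restrict A) :=
    Real.continuous_sqrt.comp_aestronglyMeasurable hgi.aestronglyMeasurable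
  have heq : (fun t => Real.sqrt (g t) ^ 2) = g := funext fun t => Real.sq_sqrt (hg0 t)
  have hsq : MemLp (fun t => Real.sqrt (g t)) 2 (volume.restrict A) := by
    rw [memLp_two_iff_integrable_sq hmeas, heq]
    exact hgi
  have h1 : MemLp (fun _ : ℝ => (1:ℝ)) (ENNReal.ofReal 2) (volume.restrict A) := by
    rw [ENNReal.ofReal_ofNat]
    exact memLp_const 1
  have h2 : MemLp (fun t => Real.sqrt (g t)) (ENNReal.ofReal 2) (volume.restrict A) := by
    rw [ENNReal.ofReal_ofNat]
    exact hsq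
  have hH := integral_mul_le_Lp_mul_Lq_of_nonneg (μ := volume.restrict A) Real.HolderConjugate.two_two
    (ae_of_all _ fun _ => zero_le_one) (ae_of_all _ fun t => Real.sqrt_nonneg (g t)) h1 h2
  have hA1 : ∫ _ in A, (1:ℝ) ^ (2:ℝ) = (volume A).toReal := by
    rw [Real.one_rpow, setIntegral_const, measureReal_def, smul_eq_mul, mul_one]
  have hg2 : ∫ t in A, Real.sqrt (g t) ^ (2:ℝ) = ∫ t in A, g t := by
    refine integral_congr_ae (ae_of_all _ fun t => ?_)
    show Real.sqrt (g t) ^ (2:ℝ) = g t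
    rw [Real.rpow_two, Real.sq_sqrt (hg0 t)]
  rw [hA1, hg2] at hH
  simp only [one_mul] at hH
  rw [Real.sqrt_eq_rpow, Real.sqrt_eq_rpow]
  exact hH

/-- **Duty-cycle bookkeeping** (pure real analysis). On `(0, T]` let `P ≥ −F√e` pointwise (`F ≥ 0`, `e ≥ 0`, both
integrable), let `P ≥ β ≥ 0` on the instants of a set `G ⊆ [0, T]` of (outer) measure `≥ δT`, the loud set
`{t ∈ (0, T] : β ≤ P t}` being measurable, and let `∫₀ᵀ e ≤ E'T`. Then the running mean of `P` is at least
`βδ − F√((1−δ)E')`: `∫_{loud} P ≥ β·δT`, and on the complement (measure `≤ (1−δ)T`) Cauchy–Schwarz in time gives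
`∫ P ≥ −F ∫√e ≥ −F√((1−δ)T)√(E'T)`. -/
theorem dutyCycle_bookkeeping {P e : ℝ → ℝ} {T β δ F E' : ℝ} {G : Set ℝ} (hT : 0 < T) (hβ : 0 ≤ β)
    (hF : 0 ≤ F) (hPi : IntegrableOn P (Ioc 0 T)) (hei : IntegrableOn e (Ioc 0 T)) (he0 : ∀ t, 0 ≤ e t)
    (hPe : ∀ t ∈ Ioc 0 T, -(F * Real.sqrt (e t)) ≤ P t)
    (hLm : MeasurableSet {t | t ∈ Ioc 0 T ∧ β ≤ P t})
    (hG : G ⊆ {t | t ∈ Icc 0 T ∧ β ≤ P t}) (hδT : δ * T ≤ (volume G).toReal)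
    (hE' : ∫ t in Ioc 0 T, e t ≤ E' * T) :
    β * δ - F * Real.sqrt ((1 - δ) * E') ≤ timeMean P T := by
  set L : Set ℝ := {t | t ∈ Ioc 0 T ∧ β ≤ P t} with hL
  have hLsub : L ⊆ Ioc 0 T := fun t ht => ht.1
  have hvolIoc : volume (Ioc (0:ℝ) T) = ENNReal.ofReal T := by
    rw [Real.volume_Ioc, sub_zero]
  have hIocfin : volume (Ioc (0:ℝ) T) ≠ ∞ := by
    rw [hvolIoc]
    exact ENNReal.ofReal_ne_top
  have hvolL : volume L ≤ volume (Ioc 0 T) := measure_mono hLsub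
  have hLfin : volume L ≠ ∞ := ne_top_of_le_ne_top hIocfin hvolL
  set m : ℝ := (volume L).toReal with hm
  have hmT : m ≤ T := by
    have := ENNReal.toReal_mono hIocfin hvolL
    rwa [hvolIoc, ENNReal.toReal_ofReal hT.le] at this
  -- the density set `G ⊆ L ∪ {0}`, so `δT ≤ m`
  have hGL : G ⊆ L ∪ {0} := by
    intro t ht
    obtain ⟨⟨h0, htT⟩, hβt⟩ := hG ht
    rcases h0.eq_or_lt with h00 | hpos
    · exact Or.inr (mem_singleton_iff.2 h00.symm)
    · exact Or.inl ⟨⟨hpos, htT⟩, hβt⟩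
  have hδm : δ * T ≤ m := by
    have h1 : volume G ≤ volume L := by
      refine (measure_mono hGL).trans ((measure_union_le _ _).trans ?_)
      rw [Real.volume_singleton, add_zero]
    exact hδT.trans (ENNReal.toReal_mono hLfin h1)
  have hδ1 : δ ≤ 1 := by
    by_contra hcon
    push Not at hcon
    nlinarith
  -- the complement of the loud set inside `(0, T]`
  set Lc : Set ℝ := Ioc 0 T \ L with hLc
  have hLcsub : Lc ⊆ Ioc 0 T := sdiff_subset
  have hLcm : MeasurableSet Lc := measurableSet_Ioc.diff hLm
  have hLcfin : volume Lc ≠ ∞ := ne_top_of_le_ne_top hIocfin (measure_mono hLcsub)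
  have hvolLc : (volume Lc).toReal = T - m := by
    rw [hLc, measure_sdiff hLsub hLm.nullMeasurableSet hLfin, ENNReal.toReal_sub_of_le hvolL hIocfin, hvolIoc,
      ENNReal.toReal_ofReal hT.le]
  -- split `∫_{(0,T]} P = ∫_L P + ∫_{Lc} P`
  have hsplit : ∫ t in Ioc 0 T, P t = (∫ t in L, P t) + ∫ t in Lc, P t := by
    have := integral_inter_add_sdiff hLm hPi
    rw [inter_eq_right.2 hLsub] at this
    rw [← this]
  -- loud part
  have hL_lb : β * m ≤ ∫ t in L, P t := by
    have h1 : ∫ _ in L, β = β * m := by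
      rw [setIntegral_const, measureReal_def, smul_eq_mul, mul_comm]
    rw [← h1]
    exact setIntegral_mono_on (integrableOn_const hLfin) (hPi.mono_set hLsub) hLm fun t ht => ht.2
  -- quiet part
  have hLc_lb : -(F * (Real.sqrt (T - m) * Real.sqrt (∫ t in Ioc 0 T, e t))) ≤ ∫ t in Lc, P t := by
    have hsi : IntegrableOn (fun t => Real.sqrt (e t)) Lc :=
      (integrableOn_sqrt hIocfin he0 hei).mono_set hLcsub
    have h1 : ∫ t in Lc, -(F * Real.sqrt (e t)) ≤ ∫ t in Lc, P t :=
      setIntegral_mono_on (hsi.const_mul F).neg (hPi.mono_set hLcsub) hLcm fun t ht => hPe t (hLcsub ht)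
    have h2 : ∫ t in Lc, -(F * Real.sqrt (e t)) = -(F * ∫ t in Lc, Real.sqrt (e t)) := by
      rw [integral_neg, integral_const_mul]
    have h3 : ∫ t in Lc, Real.sqrt (e t) ≤ Real.sqrt (T - m) * Real.sqrt (∫ t in Lc, e t) := by
      have := setIntegral_sqrt_le hLcfin he0 (hei.mono_set hLcsub)
      rwa [hvolLc] at this
    have h4 : ∫ t in Lc, e t ≤ ∫ t in Ioc 0 T, e t :=
      setIntegral_mono_set hei (ae_of_all _ fun t => he0 t) (ae_of_all _ hLcsub)
    have h5 : Real.sqrt (T - m) * Real.sqrt (∫ t in Lc, e t) ≤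
        Real.sqrt (T - m) * Real.sqrt (∫ t in Ioc 0 T, e t) :=
      mul_le_mul_of_nonneg_left (Real.sqrt_le_sqrt h4) (Real.sqrt_nonneg _)
    have h6 := mul_le_mul_of_nonneg_left (h3.trans h5) hF
    rw [h2] at h1
    linarith
  -- `√(T - m) √(∫e) ≤ T √((1-δ)E')`
  have key : Real.sqrt (T - m) * Real.sqrt (∫ t in Ioc 0 T, e t) ≤ T * Real.sqrt ((1 - δ) * E') := by
    have h0 : 0 ≤ (1 - δ) * T := mul_nonneg (sub_nonneg.2 hδ1) hT.le
    have e1 : Real.sqrt ((1 - δ) * T) * Real.sqrt (E' * T) = Real.sqrt ((1 - δ) * E' * (T * T)) := by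
      rw [← Real.sqrt_mul h0]
      congr 1
      ring
    have e2 : Real.sqrt ((1 - δ) * E' * (T * T)) = Real.sqrt ((1 - δ) * E') * T := by
      rw [Real.sqrt_mul' _ (mul_self_nonneg T), Real.sqrt_mul_self hT.le]
    calc Real.sqrt (T - m) * Real.sqrt (∫ t in Ioc 0 T, e t)
        ≤ Real.sqrt ((1 - δ) * T) * Real.sqrt (E' * T) :=
          mul_le_mul (Real.sqrt_le_sqrt (by nlinarith)) (Real.sqrt_le_sqrt hE') (Real.sqrt_nonneg _)
            (Real.sqrt_nonneg _)
      _ = T * Real.sqrt ((1 - δ) * E') := by rw [e1, e2, mul_comm]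
  have hI : T * (β * δ - F * Real.sqrt ((1 - δ) * E')) ≤ ∫ t in Ioc 0 T, P t := by
    rw [hsplit]
    have h7 := mul_le_mul_of_nonneg_left key hF
    have h8 := mul_le_mul_of_nonneg_left hδm hβ
    nlinarith [hL_lb, hLc_lb, h7, h8]
  unfold timeMean
  rw [intervalIntegral.integral_of_le hT.le]
  have e3 : β * δ - F * Real.sqrt ((1 - δ) * E') = T⁻¹ * (T * (β * δ - F * Real.sqrt ((1 - δ) * E'))) := by
    rw [← mul_assoc, inv_mul_cancel₀ hT.ne', one_mul]
  rw [e3]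
  exact mul_le_mul_of_nonneg_left hI (inv_nonneg.2 hT.le)

/-! ### §2 The registered stub `stub_highDutyBookkeeping` -/

/-- **High-duty bookkeeping** — verbatim `stub_highDutyBookkeeping` of the registered BC3 skeleton of item 27339
(`SlimDensityRealisesPower_birth(_paste).lean`): along a global Leray–Hopf trajectory with steady smooth mean-zero
force `f`, viscosity `ν > 0`, mean energy `≤ E` and a ν-free Lebesgue duty cycle `δ` of loud (`β ≤ (f, u(t))`)
slim restart-good instants along times `T → ∞`, the limsup mean injected power is at least `β·δ − ‖f‖₂·√((1−δ)·E)`. -/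
theorem highDutyBookkeeping : ∀ f : UnitAddTorus (Fin 3) → EuclideanSpace ℝ (Fin 3), Literature.Analysis.FunctionSpaces.Torus.IsSmooth f → Literature.Analysis.FunctionSpaces.Torus.IsDivFree f → Literature.Analysis.FunctionSpaces.Torus.HasZeroMean f → ∀ ν : ℝ, 0 < ν → ∀ (u₀ : UnitAddTorus (Fin 3) → EuclideanSpace ℝ (Fin 3)) (u : ℝ → UnitAddTorus (Fin 3) → EuclideanSpace ℝ (Fin 3)), Literature.Analysis.FluidPDE.Torus.IsGlobalLerayHopf ν (fun _ => f) u₀ u → ∀ B β δ E : ℝ, 0 < β → 0 < δ → Literature.Analysis.FluidPDE.meanEnergy u ≤ E → (∀ T₀ : ℝ, ∃ T : ℝ, T₀ ≤ T ∧ δ * T ≤ (MeasureTheory.volume {t : ℝ | t ∈ Set.Icc 0 T ∧ Literature.Analysis.FluidPDE.Torus.IsGlobalLerayHopf ν (fun _ => f) (u t) (fun τ => u (τ + t)) ∧ (∫ x, ‖u t x‖ ^ 2) ≤ B ∧ β ≤ ∫ x, inner ℝ (f x) (u t x)}).toReal) → β * δ - Real.sqrt (∫ x, ‖f x‖ ^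 2) * Real.sqrt ((1 - δ) * E) ≤ Literature.Analysis.FluidPDE.meanPower f u := by
  intro f hfs _hfd hfm ν hν u₀ u hu B β δ E hβ _hδ hE hdense
  set Ef : ℝ := Real.sqrt (∫ x, ‖f x‖ ^ 2) with hEf
  have hEf0 : 0 ≤ Ef := Real.sqrt_nonneg _
  set P : ℝ → ℝ := fun t => ∫ x, ⟪f x, u t x⟫ with hP
  set e : ℝ → ℝ := fun t => ∫ x, ‖u t x‖ ^ 2 with he
  have he0 : ∀ t, 0 ≤ e t := fun t => integral_nonneg fun x => sq_nonneg _
  have hfL2 : MemLp f 2 volume := hfs.memLp 2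
  -- uniform energy bound and the pointwise Cauchy–Schwarz bound on the power
  obtain ⟨R, hR⟩ := hu.exists_forall_integral_norm_sq_le_of_hasZeroMean hν hfL2 hfm
  have hCS : ∀ t, 0 ≤ t → |P t| ≤ Ef * Real.sqrt (e t) := fun t ht =>
    FluidPDE.abs_integral_inner_le_sqrt_mul_sqrt hfL2 (hu.memLp_two ht)
  have hPbd : IsBoundedUnder (· ≤ ·) atTop (timeMean P) :=
    isBoundedUnder_le_timeMean (C := Ef * Real.sqrt R) fun t ht =>
      (hCS t ht.le).trans (mul_le_mul_of_nonneg_left (Real.sqrt_le_sqrt (hR t ht.le)) hEf0)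
  -- for every `η > 0`: `βδ - ‖f‖₂√((1-δ)(E+η)) ≤ ⟨(f,u)⟩`
  have hmain : ∀ η : ℝ, 0 < η → β * δ - Ef * Real.sqrt ((1 - δ) * (E + η)) ≤ meanPower f u := by
    intro η hη
    have hsup : longTimeAvgSup e < E + η := by
      rw [meanEnergy_eq_longTimeAvgSup] at hE
      exact lt_of_le_of_lt hE (by linarith)
    have hev : ∀ᶠ T in atTop, (∫ t in (0:ℝ)..T, e t) < (E + η) * T :=
      eventually_integral_lt_of_longTimeAvgSup_lt hsup (C := R) fun t ht => by
        rw [abs_of_nonneg (he0 t)]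
        exact hR t ht.le
    obtain ⟨T₁, hT₁⟩ := eventually_atTop.1 hev
    have hfreq : ∃ᶠ T in atTop, β * δ - Ef * Real.sqrt ((1 - δ) * (E + η)) ≤ timeMean P T := by
      refine frequently_atTop.2 fun a => ?_
      obtain ⟨T, hT0, hdT⟩ := hdense (max a (max T₁ 1))
      have hTa : a ≤ T := (le_max_left _ _).trans hT0
      have hT1 : T₁ ≤ T := ((le_max_left _ _).trans (le_max_right _ _)).trans hT0
      have hTpos : 0 < T := lt_of_lt_of_le one_pos (((le_max_right _ _).trans (le_max_right _ _)).trans hT0)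
      refine ⟨T, hTa, ?_⟩
      have hLH := hu T hTpos
      -- integrability of the power and of the energy on `(0, T]`
      have hPi : IntegrableOn P (Ioc 0 T) :=
        (intervalIntegrable_iff_integrableOn_Ioc_of_le hTpos.le).1 (hLH.intervalIntegrable_power hTpos hν hfL2 hfm)
      have hei : IntegrableOn e (Ioc 0 T) := hu.integrableOn_integral_norm_sq hTpos
      -- measurability of the loud set, by weak `L²` continuity
      have hcont : ContinuousOn P (Ioc 0 T) := by
        refine (hLH.weak_continuous f hfL2).1.congr fun t _ => ?_
        simp only [hP, real_inner_comm (f _)]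
      have hLm : MeasurableSet {t | t ∈ Ioc 0 T ∧ β ≤ P t} := by
        classical
        have hP' : Measurable ((Ioc 0 T).piecewise P fun _ => β) :=
          hcont.measurable_piecewise continuousOn_const measurableSet_Ioc
        have hset : {t | t ∈ Ioc 0 T ∧ β ≤ P t} = Ioc 0 T ∩ {t | β ≤ (Ioc 0 T).piecewise P (fun _ => β) t} := by
          ext t
          simp only [mem_setOf_eq, mem_inter_iff]
          constructor
          · rintro ⟨ht, hb⟩
            exact ⟨ht, by rwa [piecewise_eq_of_mem _ _ _ ht]⟩
          · rintro ⟨ht, hb⟩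
            exact ⟨ht, by rwa [piecewise_eq_of_mem _ _ _ ht] at hb⟩
        rw [hset]
        exact measurableSet_Ioc.inter (measurableSet_le measurable_const hP')
      have hPe : ∀ t ∈ Ioc 0 T, -(Ef * Real.sqrt (e t)) ≤ P t := fun t ht =>
        neg_le_of_abs_le (hCS t ht.1.le)
      have hE' : ∫ t in Ioc 0 T, e t ≤ (E + η) * T := by
        have := hT₁ T hT1
        rw [intervalIntegral.integral_of_le hTpos.le] at this
        exact this.le
      exact dutyCycle_bookkeeping hTpos hβ.le hEf0 hPi hei he0 hPe hLm (fun t ht => ⟨ht.1, ht.2.2.2⟩) hdT hE'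
    exact le_limsup_of_frequently_le hfreq hPbd
  -- `η → 0⁺`
  have hc : Continuous fun η : ℝ => β * δ - Ef * Real.sqrt ((1 - δ) * (E + η)) := by fun_prop
  have hlim : Tendsto (fun η : ℝ => β * δ - Ef * Real.sqrt ((1 - δ) * (E + η))) (𝓝[>] 0)
      (𝓝 (β * δ - Ef * Real.sqrt ((1 - δ) * E))) := by
    have := hc.tendsto 0
    simp only [add_zero] at this
    exact this.mono_left nhdsWithin_le_nhds
  exact le_of_tendsto hlim (eventually_nhdsWithin_of_forall fun η hη => hmain η hη)

/-- registered stub `stub_highDutyBookkeeping` of crux `DutyCycle.SlimDensityRealisesPower` (item 27339) — PROVED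
(by name + signature, for the skeleton's `SlimDensityRealisesPower_of`). -/
theorem stub_highDutyBookkeeping : ∀ f : UnitAddTorus (Fin 3) → EuclideanSpace ℝ (Fin 3), Literature.Analysis.FunctionSpaces.Torus.IsSmooth f → Literature.Analysis.FunctionSpaces.Torus.IsDivFree f → Literature.Analysis.FunctionSpaces.Torus.HasZeroMean f → ∀ ν : ℝ, 0 < ν → ∀ (u₀ : UnitAddTorus (Fin 3) → EuclideanSpace ℝ (Fin 3)) (u : ℝ → UnitAddTorus (Fin 3) → EuclideanSpace ℝ (Fin 3)), Literature.Analysis.FluidPDE.Torus.IsGlobalLerayHopf ν (fun _ => f) u₀ u → ∀ B β δ E : ℝ, 0 < β → 0 < δ → Literature.Analysis.FluidPDE.meanEnergy u ≤ E → (∀ T₀ : ℝ, ∃ T : ℝ, T₀ ≤ T ∧ δ * T ≤ (MeasureTheory.volume {t : ℝ | t ∈ Set.Icc 0 T ∧ Literature.Analysis.FluidPDE.Torus.IsGlobalLerayHopf ν (fun _ => f) (u t) (fun τ => u (τ + t)) ∧ (∫ x, ‖u t x‖ ^ 2) ≤ B ∧ β ≤ ∫ x, inner ℝ (f x) (u t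 x)}).toReal) → β * δ - Real.sqrt (∫ x, ‖f x‖ ^ 2) * Real.sqrt ((1 - δ) * E) ≤ Literature.Analysis.FluidPDE.meanPower f u :=
  highDutyBookkeeping

/-! ### §3 The door of the residual: high-duty dense slim-loud families are power-floor families -/

/-- **DOOR THEOREM for the residual Rβ2** (`SlimDensityRealisesPower`, item 27339): a dense slim-loud Leray–Hopf family
at ν-free bounded mean energy in the HIGH-DUTY regime `‖f‖₂·√((1−δ)E) < β·δ` — the ∃-statement `HighDutyDenseReturns`
of the registered BC3 skeleton, INLINED verbatim (kernel lane; no `def … : Prop` in a Theorems proof file) — is a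
`PowerFloorFamily` (item 24057, tree decl BY NAME), with the ν-free power floor `β·δ − ‖f‖₂·√((1−δ)E) > 0`. So the
residual `D_E → P` is open exactly in the complementary low-duty regime; `slimDensityRealisesPower_door ∘
stub_dutySaturation` is the skeleton's `SlimDensityRealisesPower_proof`. -/
theorem slimDensityRealisesPower_door
    (hH : ∃ f : UnitAddTorus (Fin 3) → EuclideanSpace ℝ (Fin 3), Literature.Analysis.FunctionSpaces.Torus.IsSmooth f ∧ Literature.Analysis.FunctionSpaces.Torus.IsDivFree f ∧ Literature.Analysis.FunctionSpaces.Torus.HasZeroMean f ∧ ∃ ν : ℕ → ℝ, (∀ j, 0 < ν j) ∧ Filter.Tendsto ν Filter.atTop (nhds 0) ∧ ∃ B β δ E : ℝ, 0 < β ∧ 0 < δ ∧ Real.sqrt (∫ x, ‖f x‖ ^ 2) * Real.sqrt ((1 - δ) * E) < β * δ ∧ ∀ j : ℕ, ∃ (u₀ : UnitAddTorus (Fin 3) → EuclideanSpace ℝ (Fin 3)) (u : ℝ → UnitAddTorus (Fin 3) → EuclideanSpace ℝ (Fin 3)), Literature.Analysis.FluidPDE.Torus.IsGlobalLerayHopf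 (ν j) (fun _ => f) u₀ u ∧ Literature.Analysis.FluidPDE.meanEnergy u ≤ E ∧ ∀ T₀ : ℝ, ∃ T : ℝ, T₀ ≤ T ∧ δ * T ≤ (MeasureTheory.volume {t : ℝ | t ∈ Set.Icc 0 T ∧ Literature.Analysis.FluidPDE.Torus.IsGlobalLerayHopf (ν j) (fun _ => f) (u t) (fun τ => u (τ + t)) ∧ (∫ x, ‖u t x‖ ^ 2) ≤ B ∧ β ≤ ∫ x, inner ℝ (f x) (u t x)}).toReal) :
    Summit.AnomalousDissipation.AnomalousDissipation.Theses.AttractorShadow.PowerFloorFamily := by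
  obtain ⟨f, hfs, hfd, hfm, ν, hν, hν0, B, β, δ, E, hβ, hδ, hgap, hj⟩ := hH
  choose u₀ u hLH hE hdense using hj
  refine ⟨f, hfs, hfd, hfm, ν, u₀, u, hν, hν0, hLH, ⟨E, hE⟩,
    β * δ - Real.sqrt (∫ x, ‖f x‖ ^ 2) * Real.sqrt ((1 - δ) * E), by linarith, fun j => ?_⟩
  exact highDutyBookkeeping f hfs hfd hfm (ν j) (hν j) (u₀ j) (u j) (hLH j) B β δ E hβ hδ (hE j) (hdense j)

end Summit.AnomalousDissipation.AnomalousDissipation.Theorems.DutyCycle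

end
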